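import Literature.Topology.FourManifolds.KhGaussElim
import HarnessLib

/-!
# Two-sided homotopy equivalences of total Khovanov cochains and the induced isomorphisms

Sibling file of `KhComplex.lean`, generalising `KhComplexHomotopyProofs.HtpyData` (a strong
deformation retraction `C(K) → C(G)`) to a **chain homotopy equivalence** `C(G) ≃ C(K)` with
homotopies on both sides (`HtpyEquiv`) — the shape produced by the third Reidemeister move, where
the cochains of both sides retract onto a common abstract complex but neither onto the other:

* `HtpyEquiv.ofRetractions` — two retractions (`KhElim.MHtpy`) of `C(G)` and of `C(K)` onto one
  matrix complex compose to a homotopy equivalence `C(G) ≃ C(K)`;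
* `HtpyEquiv.nonempty_iso_frobeniusHomology`, `HtpyEquiv.nonempty_iso_khovanovHomology` — a
  homotopy equivalence preserving the (bi)degrees, with homotopies lowering the homological
  degree by one, induces isomorphisms of the homology over every Frobenius system and of the
  bigraded integral Khovanov homology (`subquotientEquiv`, which is two-sided).

No named fact is introduced.

## References

* C. Weibel, *An introduction to homological algebra* (1994), §1.4 (homotopy equivalences induce
  isomorphisms on homology). [folklore]
* D. Bar-Natan, *On Khovanov's categorification of the Jones polynomial*, Algebr. Geom. Topol. 2
  (2002) 337–370, §4.4. [cite: BarNatan2002, §4]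
-/

open CategoryTheory

noncomputable section

namespace Literature.Topology.FourManifolds

namespace GaussDiagram

section Equiv

variable {R : Type} [CommRing R] {G K : GaussDiagram} {h t : R}

variable (R G K h t) in
/-- **A homotopy equivalence between the total Khovanov cochains of two Gauss diagrams**: chain
maps `F : C(G) → C(K)`, `B : C(K) → C(G)` and homotopies `B F - 1 = d H_G + H_G d`,
`F B - 1 = d H_K + H_K d`. [folklore] -/
structure HtpyEquiv where
  /-- The chain map `C(G) → C(K)`. -/
  F : (G.EnhancedState → R) →ₗ[R] (K.EnhancedState → R)
  /-- The chain map `C(K) → C(G)`. -/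
  B : (K.EnhancedState → R) →ₗ[R] (G.EnhancedState → R)
  /-- The homotopy on `C(G)`. -/
  HG : (G.EnhancedState → R) →ₗ[R] (G.EnhancedState → R)
  /-- The homotopy on `C(K)`. -/
  HK : (K.EnhancedState → R) →ₗ[R] (K.EnhancedState → R)
  /-- `F` is a chain map. -/
  F_comm : ∀ w, K.totalD R h t (F w) = F (G.totalD R h t w)
  /-- `B` is a chain map. -/
  B_comm : ∀ v, G.totalD R h t (B v) = B (K.totalD R h t v)
  /-- `B F ≃ 1`. -/
  B_F : ∀ w, B (F w) - w = G.totalD R h t (HG w) + HG (G.totalD R h t w)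
  /-- `F B ≃ 1`. -/
  F_B : ∀ v, F (B v) - v = K.totalD R h t (HK v) + HK (K.totalD R h t v)

namespace HtpyEquiv

open KhElim

/-- **Two retractions onto a common complex give a homotopy equivalence**: from
`C(G) ⟂ (T, M)` and `C(K) ⟂ (T, M)` (`KhElim.MHtpy`), the maps `F = F₂ B₁`, `B = F₁ B₂`.
Weibel (1994), §1.4. [folklore] -/
def ofRetractions {T : Type} [Fintype T] {M : T → T → R} (D₁ : MHtpy (G.incidence R h t) M)
    (D₂ : MHtpy (K.incidence R h t) M) : HtpyEquiv R G K h t where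
  F := D₂.F ∘ₗ D₁.B
  B := D₁.F ∘ₗ D₂.B
  HG := D₁.H
  HK := D₂.H
  F_comm w := by
    simp only [LinearMap.comp_apply, totalD_eq_mMap]
    rw [D₂.F_comm, D₁.B_comm]
  B_comm v := by
    simp only [LinearMap.comp_apply, totalD_eq_mMap]
    rw [D₁.F_comm, D₂.B_comm]
  B_F w := by
    simp only [LinearMap.comp_apply, totalD_eq_mMap]
    rw [D₂.B_F, D₁.F_B]
  F_B v := by
    simp only [LinearMap.comp_apply, totalD_eq_mMap]
    rw [D₁.B_F, D₂.F_B]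

/-- `ofRetractions`: the map `F`. [folklore] -/
theorem ofRetractions_F {T : Type} [Fintype T] {M : T → T → R} (D₁ : MHtpy (G.incidence R h t) M)
    (D₂ : MHtpy (K.incidence R h t) M) : (ofRetractions D₁ D₂).F = D₂.F ∘ₗ D₁.B := rfl
/-- `ofRetractions`: the map `B`. [folklore] -/
theorem ofRetractions_B {T : Type} [Fintype T] {M : T → T → R} (D₁ : MHtpy (G.incidence R h t) M)
    (D₂ : MHtpy (K.incidence R h t) M) : (ofRetractions D₁ D₂).B = D₁.F ∘ₗ D₂.B := rfl
/-- `ofRetractions`: the homotopy on `C(G)`. [folklore] -/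
theorem ofRetractions_HG {T : Type} [Fintype T] {M : T → T → R} (D₁ : MHtpy (G.incidence R h t) M)
    (D₂ : MHtpy (K.incidence R h t) M) : (ofRetractions D₁ D₂).HG = D₁.H := rfl
/-- `ofRetractions`: the homotopy on `C(K)`. [folklore] -/
theorem ofRetractions_HK {T : Type} [Fintype T] {M : T → T → R} (D₁ : MHtpy (G.incidence R h t) M)
    (D₂ : MHtpy (K.incidence R h t) M) : (ofRetractions D₁ D₂).HK = D₂.H := rfl

/-! ### Restriction to homological degrees -/

/-- The chain map `F` between the cochain groups of degree `i`. [folklore] -/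
def fDeg (D : HtpyEquiv R G K h t) (i : ℤ) : (G.degStates i → R) →ₗ[R] (K.degStates i → R) :=
  resFun R (fun s : K.EnhancedState ↦ homDegree s = i) ∘ₗ D.F ∘ₗ extZero R (fun s : G.EnhancedState ↦ homDegree s = i)

/-- The chain map `B` between the cochain groups of degree `i`. [folklore] -/
def bDeg (D : HtpyEquiv R G K h t) (i : ℤ) : (K.degStates i → R) →ₗ[R] (G.degStates i → R) :=
  resFun R (fun s : G.EnhancedState ↦ homDegree s = i) ∘ₗ D.B ∘ₗ extZero R (fun s : K.EnhancedState ↦ homDegree s = i)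

/-- The homotopy on `C(K)` between degrees `i` and `i'`. [folklore] -/
def hKDeg (D : HtpyEquiv R G K h t) (i i' : ℤ) : (K.degStates i → R) →ₗ[R] (K.degStates i' → R) :=
  resFun R (fun s : K.EnhancedState ↦ homDegree s = i') ∘ₗ D.HK ∘ₗ extZero R (fun s : K.EnhancedState ↦ homDegree s = i)

/-- The homotopy on `C(G)` between degrees `i` and `i'`. [folklore] -/
def hGDeg (D : HtpyEquiv R G K h t) (i i' : ℤ) : (G.degStates i → R) →ₗ[R] (G.degStates i' → R) :=
  resFun R (fun s : G.EnhancedState ↦ homDegree s = i') ∘ₗ D.HG ∘ₗ extZero R (fun s : G.EnhancedState ↦ homDegree s = i)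

variable (D : HtpyEquiv R G K h t)
  (suppF : ∀ (i : ℤ) (w : G.EnhancedState → R), SuppDeg i w → SuppDeg i (D.F w))
  (suppB : ∀ (i : ℤ) (v : K.EnhancedState → R), SuppDeg i v → SuppDeg i (D.B v))
  (suppHG : ∀ (i : ℤ) (w : G.EnhancedState → R), SuppDeg i w → SuppDeg (i - 1) (D.HG w))
  (suppHK : ∀ (i : ℤ) (v : K.EnhancedState → R), SuppDeg i v → SuppDeg (i - 1) (D.HK v))

include suppF in
/-- `F` is a chain map degreewise. [folklore] -/
theorem khovanovD_fDeg (i : ℤ) (v : G.degStates i → R) :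
    K.khovanovD R h t i (i + 1) (D.fDeg i v) = D.fDeg (i + 1) (G.khovanovD R h t i (i + 1) v) := by
  simp only [fDeg, LinearMap.comp_apply]
  rw [← resFun_totalD_extZero, ← resFun_totalD_extZero, extZero_resFun (suppF i _ (suppDeg_extZero i v)),
    extZero_resFun (suppDeg_totalD h t (suppDeg_extZero i v)), D.F_comm]

include suppB in
/-- `B` is a chain map degreewise. [folklore] -/
theorem khovanovD_bDeg (i : ℤ) (v : K.degStates i → R) :
    G.khovanovD R h t i (i + 1) (D.bDeg i v) = D.bDeg (i + 1) (K.khovanovD R h t i (i + 1) v) := by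
  simp only [bDeg, LinearMap.comp_apply]
  rw [← resFun_totalD_extZero, ← resFun_totalD_extZero, extZero_resFun (suppB i _ (suppDeg_extZero i v)),
    extZero_resFun (suppDeg_totalD h t (suppDeg_extZero i v)), D.B_comm]

include suppB suppHK in
/-- `F B - 1 = d H + H d` degreewise. [folklore] -/
theorem fDeg_bDeg_sub (i : ℤ) (y : K.degStates i → R) :
    D.fDeg i (D.bDeg i y) - y = K.khovanovD R h t (i - 1) i (D.hKDeg i (i - 1) y) +
      D.hKDeg (i + 1) i (K.khovanovD R h t i (i + 1) y) := by
  simp only [fDeg, bDeg, hKDeg, LinearMap.comp_apply]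
  rw [← resFun_totalD_extZero, ← resFun_totalD_extZero, extZero_resFun (suppB i _ (suppDeg_extZero i y)),
    extZero_resFun (suppDeg_totalD h t (suppDeg_extZero i y))]
  have hH : extZero R (fun s : K.EnhancedState ↦ homDegree s = i - 1)
      (resFun R (fun s : K.EnhancedState ↦ homDegree s = i - 1) (D.HK (extZero R (fun s : K.EnhancedState ↦ homDegree s = i) y))) =
      D.HK (extZero R (fun s : K.EnhancedState ↦ homDegree s = i) y) :=
    extZero_resFun (suppHK i _ (suppDeg_extZero i y))
  rw [hH]
  have key := congrArg (resFun R (fun s : K.EnhancedState ↦ homDegree s = i))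
    (D.F_B (extZero R (fun s : K.EnhancedState ↦ homDegree s = i) y))
  rw [map_sub, map_add, resFun_extZero] at key
  exact key

include suppF suppHG in
/-- `B F - 1 = d H + H d` degreewise. [folklore] -/
theorem bDeg_fDeg_sub (i : ℤ) (w : G.degStates i → R) :
    D.bDeg i (D.fDeg i w) - w = G.khovanovD R h t (i - 1) i (D.hGDeg i (i - 1) w) +
      D.hGDeg (i + 1) i (G.khovanovD R h t i (i + 1) w) := by
  simp only [fDeg, bDeg, hGDeg, LinearMap.comp_apply]
  rw [← resFun_totalD_extZero, ← resFun_totalD_extZero, extZero_resFun (suppF i _ (suppDeg_extZero i w)),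
    extZero_resFun (suppDeg_totalD h t (suppDeg_extZero i w))]
  have hH : extZero R (fun s : G.EnhancedState ↦ homDegree s = i - 1)
      (resFun R (fun s : G.EnhancedState ↦ homDegree s = i - 1) (D.HG (extZero R (fun s : G.EnhancedState ↦ homDegree s = i) w))) =
      D.HG (extZero R (fun s : G.EnhancedState ↦ homDegree s = i) w) :=
    extZero_resFun (suppHG i _ (suppDeg_extZero i w))
  rw [hH]
  have key := congrArg (resFun R (fun s : G.EnhancedState ↦ homDegree s = i))
    (D.B_F (extZero R (fun s : G.EnhancedState ↦ homDegree s = i) w))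
  rw [map_sub, map_add, resFun_extZero] at key
  exact key

include suppF suppB suppHG suppHK in
/-- **A degree-preserving homotopy equivalence induces isomorphisms of the homology over the
universal Frobenius system** in every homological degree. Weibel (1994), §1.4; Bar-Natan (2002),
§4.4. [folklore] -/
theorem nonempty_iso_frobeniusHomology (i : ℤ) :
    Nonempty (G.frobeniusHomology R h t i ≅ K.frobeniusHomology R h t i) := by
  refine ⟨(subquotientEquiv (G.khovanovD R h t (i - 1) i) (G.khovanovD R h t i (i + 1))
    (K.khovanovD R h t (i - 1) i) (K.khovanovD R h t i (i + 1)) (D.fDeg i) (D.bDeg i)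
    (fun x hx ↦ ?_) (fun x₀ ↦ ?_) (fun y hy ↦ ?_) (fun y₀ ↦ ?_) (fun x hx ↦ ⟨D.hGDeg i (i - 1) x, ?_⟩)
    (fun y hy ↦ ⟨D.hKDeg i (i - 1) y, ?_⟩)).toModuleIso⟩
  · rw [D.khovanovD_fDeg suppF, hx, map_zero]
  · refine ⟨D.fDeg (i - 1) x₀, ?_⟩
    have := D.khovanovD_fDeg suppF (i - 1) x₀
    rw [sub_add_cancel] at this
    exact this
  · rw [D.khovanovD_bDeg suppB, hy, map_zero]
  · refine ⟨D.bDeg (i - 1) y₀, ?_⟩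
    have := D.khovanovD_bDeg suppB (i - 1) y₀
    rw [sub_add_cancel] at this
    exact this
  · rw [D.bDeg_fDeg_sub suppF suppHG, hx, map_zero, add_zero]
  · rw [D.fDeg_bDeg_sub suppB suppHK, hy, map_zero, add_zero]

/-! ### Restriction to bidegrees (integral theory at `h = t = 0`) -/

variable (E : HtpyEquiv ℤ G K 0 0)

/-- The chain map `F` between the bigraded cochain groups. [folklore] -/
def fBideg (i j : ℤ) : (G.bidegStates i j → ℤ) →ₗ[ℤ] (K.bidegStates i j → ℤ) :=
  resFun ℤ (fun s : K.EnhancedState ↦ homDegree s = i ∧ qDegree s = j) ∘ₗ E.F ∘ₗ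
    extZero ℤ (fun s : G.EnhancedState ↦ homDegree s = i ∧ qDegree s = j)

/-- The chain map `B` between the bigraded cochain groups. [folklore] -/
def bBideg (i j : ℤ) : (K.bidegStates i j → ℤ) →ₗ[ℤ] (G.bidegStates i j → ℤ) :=
  resFun ℤ (fun s : G.EnhancedState ↦ homDegree s = i ∧ qDegree s = j) ∘ₗ E.B ∘ₗ
    extZero ℤ (fun s : K.EnhancedState ↦ homDegree s = i ∧ qDegree s = j)

/-- The homotopy on `C(K)` between bidegrees `(i, j)` and `(i', j)`. [folklore] -/
def hKBideg (i i' j : ℤ) : (K.bidegStates i j → ℤ) →ₗ[ℤ] (K.bidegStates i' j → ℤ) :=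
  resFun ℤ (fun s : K.EnhancedState ↦ homDegree s = i' ∧ qDegree s = j) ∘ₗ E.HK ∘ₗ
    extZero ℤ (fun s : K.EnhancedState ↦ homDegree s = i ∧ qDegree s = j)

/-- The homotopy on `C(G)` between bidegrees `(i, j)` and `(i', j)`. [folklore] -/
def hGBideg (i i' j : ℤ) : (G.bidegStates i j → ℤ) →ₗ[ℤ] (G.bidegStates i' j → ℤ) :=
  resFun ℤ (fun s : G.EnhancedState ↦ homDegree s = i' ∧ qDegree s = j) ∘ₗ E.HG ∘ₗ
    extZero ℤ (fun s : G.EnhancedState ↦ homDegree s = i ∧ qDegree s = j)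

variable
  (suppF₂ : ∀ (i j : ℤ) (w : G.EnhancedState → ℤ), SuppBideg i j w → SuppBideg i j (E.F w))
  (suppB₂ : ∀ (i j : ℤ) (v : K.EnhancedState → ℤ), SuppBideg i j v → SuppBideg i j (E.B v))
  (suppHG₂ : ∀ (i j : ℤ) (w : G.EnhancedState → ℤ), SuppBideg i j w → SuppBideg (i - 1) j (E.HG w))
  (suppHK₂ : ∀ (i j : ℤ) (v : K.EnhancedState → ℤ), SuppBideg i j v → SuppBideg (i - 1) j (E.HK v))

include suppF₂ in
/-- `F` is a chain map in each bidegree. [folklore] -/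
theorem khovanovDQ_fBideg (i j : ℤ) (v : G.bidegStates i j → ℤ) :
    K.khovanovDQ i (i + 1) j (E.fBideg i j v) = E.fBideg (i + 1) j (G.khovanovDQ i (i + 1) j v) := by
  simp only [fBideg, LinearMap.comp_apply]
  rw [← resFun_totalD_extZero_bideg, ← resFun_totalD_extZero_bideg,
    extZero_resFun (suppF₂ i j _ (suppBideg_extZero i j v)),
    extZero_resFun (suppBideg_totalD (suppBideg_extZero i j v)), E.F_comm]

include suppB₂ in
/-- `B` is a chain map in each bidegree. [folklore] -/
theorem khovanovDQ_bBideg (i j : ℤ) (v : K.bidegStates i j → ℤ) :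
    G.khovanovDQ i (i + 1) j (E.bBideg i j v) = E.bBideg (i + 1) j (K.khovanovDQ i (i + 1) j v) := by
  simp only [bBideg, LinearMap.comp_apply]
  rw [← resFun_totalD_extZero_bideg, ← resFun_totalD_extZero_bideg,
    extZero_resFun (suppB₂ i j _ (suppBideg_extZero i j v)),
    extZero_resFun (suppBideg_totalD (suppBideg_extZero i j v)), E.B_comm]

include suppB₂ suppHK₂ in
/-- `F B - 1 = d H + H d` in each bidegree. [folklore] -/
theorem fBideg_bBideg_sub (i j : ℤ) (y : K.bidegStates i j → ℤ) :
    E.fBideg i j (E.bBideg i j y) - y = K.khovanovDQ (i - 1) i j (E.hKBideg i (i - 1) j y) +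
      E.hKBideg (i + 1) i j (K.khovanovDQ i (i + 1) j y) := by
  simp only [fBideg, bBideg, hKBideg, LinearMap.comp_apply]
  rw [← resFun_totalD_extZero_bideg, ← resFun_totalD_extZero_bideg,
    extZero_resFun (suppB₂ i j _ (suppBideg_extZero i j y)),
    extZero_resFun (suppBideg_totalD (suppBideg_extZero i j y))]
  have hH : extZero ℤ (fun s : K.EnhancedState ↦ homDegree s = i - 1 ∧ qDegree s = j)
      (resFun ℤ (fun s : K.EnhancedState ↦ homDegree s = i - 1 ∧ qDegree s = j)
        (E.HK (extZero ℤ (fun s : K.EnhancedState ↦ homDegree s = i ∧ qDegree s = j) y))) =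
      E.HK (extZero ℤ (fun s : K.EnhancedState ↦ homDegree s = i ∧ qDegree s = j) y) :=
    extZero_resFun (suppHK₂ i j _ (suppBideg_extZero i j y))
  rw [hH]
  have key := congrArg (resFun ℤ (fun s : K.EnhancedState ↦ homDegree s = i ∧ qDegree s = j))
    (E.F_B (extZero ℤ (fun s : K.EnhancedState ↦ homDegree s = i ∧ qDegree s = j) y))
  rw [map_sub, map_add, resFun_extZero] at key
  exact key

include suppF₂ suppHG₂ in
/-- `B F - 1 = d H + H d` in each bidegree. [folklore] -/
theorem bBideg_fBideg_sub (i j : ℤ) (w : G.bidegStates i j → ℤ) :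
    E.bBideg i j (E.fBideg i j w) - w = G.khovanovDQ (i - 1) i j (E.hGBideg i (i - 1) j w) +
      E.hGBideg (i + 1) i j (G.khovanovDQ i (i + 1) j w) := by
  simp only [fBideg, bBideg, hGBideg, LinearMap.comp_apply]
  rw [← resFun_totalD_extZero_bideg, ← resFun_totalD_extZero_bideg,
    extZero_resFun (suppF₂ i j _ (suppBideg_extZero i j w)),
    extZero_resFun (suppBideg_totalD (suppBideg_extZero i j w))]
  have hH : extZero ℤ (fun s : G.EnhancedState ↦ homDegree s = i - 1 ∧ qDegree s = j)
      (resFun ℤ (fun s : G.EnhancedState ↦ homDegree s = i - 1 ∧ qDegree s = j)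
        (E.HG (extZero ℤ (fun s : G.EnhancedState ↦ homDegree s = i ∧ qDegree s = j) w))) =
      E.HG (extZero ℤ (fun s : G.EnhancedState ↦ homDegree s = i ∧ qDegree s = j) w) :=
    extZero_resFun (suppHG₂ i j _ (suppBideg_extZero i j w))
  rw [hH]
  have key := congrArg (resFun ℤ (fun s : G.EnhancedState ↦ homDegree s = i ∧ qDegree s = j))
    (E.B_F (extZero ℤ (fun s : G.EnhancedState ↦ homDegree s = i ∧ qDegree s = j) w))
  rw [map_sub, map_add, resFun_extZero] at key
  exact key

include suppF₂ suppB₂ suppHG₂ suppHK₂ in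
/-- **A bidegree-preserving homotopy equivalence (homotopies of bidegree `(-1, 0)`) induces
isomorphisms of the bigraded integral Khovanov homology** in every bidegree. Weibel (1994), §1.4;
Khovanov (2000), §5; Bar-Natan (2002), §4.4. [cite: Khovanov2000, §5] -/
theorem nonempty_iso_khovanovHomology (i j : ℤ) :
    Nonempty (G.khovanovHomology i j ≅ K.khovanovHomology i j) := by
  refine ⟨(subquotientEquiv (G.khovanovDQ (i - 1) i j) (G.khovanovDQ i (i + 1) j)
    (K.khovanovDQ (i - 1) i j) (K.khovanovDQ i (i + 1) j) (E.fBideg i j) (E.bBideg i j)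
    (fun x hx ↦ ?_) (fun x₀ ↦ ?_) (fun y hy ↦ ?_) (fun y₀ ↦ ?_) (fun x hx ↦ ⟨E.hGBideg i (i - 1) j x, ?_⟩)
    (fun y hy ↦ ⟨E.hKBideg i (i - 1) j y, ?_⟩)).toModuleIso⟩
  · rw [E.khovanovDQ_fBideg suppF₂, hx, map_zero]
  · refine ⟨E.fBideg (i - 1) j x₀, ?_⟩
    have := E.khovanovDQ_fBideg suppF₂ (i - 1) j x₀
    rw [sub_add_cancel] at this
    exact this
  · rw [E.khovanovDQ_bBideg suppB₂, hy, map_zero]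
  · refine ⟨E.bBideg (i - 1) j y₀, ?_⟩
    have := E.khovanovDQ_bBideg suppB₂ (i - 1) j y₀
    rw [sub_add_cancel] at this
    exact this
  · rw [E.bBideg_fBideg_sub suppF₂ suppHG₂, hx, map_zero, add_zero]
  · rw [E.fBideg_bBideg_sub suppB₂ suppHK₂, hy, map_zero, add_zero]

end HtpyEquiv

end Equiv

end GaussDiagram

end Literature.Topology.FourManifolds
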